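import Literature.AlgebraicGeometry.Frobenioids.BaseFrobeniusSections
import Literature.AlgebraicGeometry.Frobenioids.DivisorialDescriptions
import HarnessLib

/-!
# Frobenioids I, Remark 2.9.2: the `Aut`-ampleness hypothesis of Prop. 2.9 is superfluous — proof modulo Thm. 5.1 (iii)

Mochizuki, *The geometry of Frobenioids I*, Kyushu J. Math. **62** (2008), §2, Remark 2.9.2,
kurims p. 55 [cite: MochizukiFrdI2008, Rem. 2.9.2 p.55]: "We shall see later [cf. Theorem 5.1,
(iii)] that in fact, the `Aut`-ampleness hypothesis in the statement of Proposition 2.9 is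
superfluous."  Proof-only companion of `BaseFrobeniusSections.lean` (statement
`PreFrobenioid.AutAmpleSuperfluous`, abc-iut-L1-t2): every object of a base-trivial Frobenioid is
isomorphic to a Frobenius-trivial one (Def. 1.3 (i)(a)), `Aut`-ampleness is invariant under
isomorphism, and Frobenius-trivial objects are `Aut`-ample by Thm. 5.1 (iii) — taken here as the
NAMED statement `Thm51iii_frobeniusTrivial_isAutAmple F` of `DivisorialDescriptions.lean`
(abc-iut-L1-t5), whose proof (abc-iut-found, `DivisorialDescriptionsIII.lean`) is staged but not yet
in the tree; the unconditional `AutAmpleSuperfluous_holds` is then a one-line corollary.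

No new definitions (theorems only).
-/

namespace Literature.AlgebraicGeometry.Frobenioids

open CategoryTheory

universe w v v' u u'

namespace PreFrobenioid

variable {D : Type u} [Category.{v} D] {Φ : Dᵒᵖ ⥤ CommMonCat.{w}}
  {C : Type u'} [Category.{v'} C] (F : C ⥤ ElemFrobenioid Φ)

/-- `Aut`-ampleness (surjectivity of `Aut_C(A) → Aut_D(A_D)`, Def. 1.2 (iv)) is invariant under
isomorphism: conjugate by the isomorphism and its base. [cite: MochizukiFrdI2008, Rem. 2.9.2 p.55] -/
theorem IsAutAmple.of_iso {A A' : C} (e : A ≅ A') (h : IsAutAmple F A') : IsAutAmple F A := by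
  intro α
  obtain ⟨β', hβ'⟩ := h ((baseFunctor F).mapIso e.symm ≪≫ α ≪≫ (baseFunctor F).mapIso e)
  refine ⟨e ≪≫ β' ≪≫ e.symm, ?_⟩
  have h1 : (baseFunctor F).map β'.hom =
      (baseFunctor F).map e.inv ≫ α.hom ≫ (baseFunctor F).map e.hom := by
    simpa using congrArg Iso.hom hβ'
  ext
  simp only [Functor.mapIso_hom, Iso.trans_hom, Iso.symm_hom, Functor.map_comp, h1,
    Category.assoc]
  rw [← (baseFunctor F).map_comp, e.hom_inv_id, (baseFunctor F).map_id, Category.comp_id,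
    ← Category.assoc, ← (baseFunctor F).map_comp, e.hom_inv_id, (baseFunctor F).map_id,
    Category.id_comp]

/-- **Rmk. 2.9.2 modulo Thm. 5.1 (iii)**: if all Frobenius-trivial objects of `C` are `Aut`-ample
(the named statement `Thm51iii_frobeniusTrivial_isAutAmple F` of Thm. 5.1 (iii)), then a Frobenioid of
Frobenius-normalized, base-trivial and isotropic type is of `Aut`-ample type: every object is
isomorphic (base-triviality) to a Frobenius-trivial object over the same base (Def. 1.3 (i)(a)).
(Frobenius-normalizedness is not used.) [cite: MochizukiFrdI2008, Rem. 2.9.2 p.55] -/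
theorem autAmpleSuperfluous_of_thm51iii (h51 : Thm51iii_frobeniusTrivial_isAutAmple F) :
    AutAmpleSuperfluous F := by
  intro hF _hnorm hbt hiso A
  obtain ⟨A', hA', ⟨e'⟩⟩ := hF.i_a (baseObj F A)
  obtain ⟨e⟩ := hbt A' A ⟨e'⟩
  exact IsAutAmple.of_iso F e (h51 hF hiso A' hA')

end PreFrobenioid

end Literature.AlgebraicGeometry.Frobenioids
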